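import Summits.HodgeConjecture.FermatCycles.ShiodaConditionFourfold
import HarnessLib

/-!
# Shioda's condition `(P⁴ₘ)` by kernel exhaustion: the unit-normalised search

HONEST FRAMING: explicit algebraic cycles for specific Hodge classes on Fermat/Delsarte varieties;
residual open instances listed; no claim on general Hodge.

Companion of `ShiodaConditionFourfold.lean` (sound search `checkB6`, `(P⁴₃₉)`; `(P⁴₅₁)`, `(P⁴₅₇)` in the sibling files), cell
`pub-hfermat`, topic path `Summits/HodgeConjecture/FermatCycles/` (new work, not literature). This file divides the search by the unit
group: Shioda's condition and all three decomposability notions are invariant under `s ↦ u·s` for `u ∈ (ℤ/N)ˣ` (proved here: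
`isHodgeMultiset_map_unit`, `isDecomposable_map_unit`, `isQuasiDecomposable_map_unit`, `isSemiDecomposable_map_unit`), and every
multiset either contains a unit entry — scale it to `1` — or consists of non-units. So `(P⁴_N)` follows from two searches: `checkU`
over the sorted `5`-tuples `b ≤ c ≤ d ≤ e ≤ f` with `1 + b + ⋯ + f = 3N`, and `checkNU` over the sorted `6`-tuples of NON-UNITS with
`Σ = 3N` (soundness `shiodaConditionUpTo_four_of_normalized`). At `N = 69` this is `93 772 + 10 842` candidates instead of
`1 329 352` (`code/lit/p39/proto_norm.py`), at `N = 87, 93` it is `233 188 + 29 645`, `303 255 + 39 726`. The certificates themselves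
(`ShiodaConditionUpTo 69 4`, `87`, `93` — the last three of the six degrees `39, 51, 57, 69, 87, 93 ≤ 100` at which the cell's enumeration
(P4-TABLE, two implementations + referee) finds `(P⁴ₘ)` TRUE in the Proc. Japan Acad. / da Silva form with no refereed theorem for `X⁴ₘ`; see PRINT STATUS) are the
sibling files `ShiodaConditionFourfoldSixtyNine.lean`, `…EightySeven.lean`, `…NinetyThree.lean`.

PRINT STATUS (lit seat, 2026-08-20): no REFEREED theorem covers this degree; PUBLIC PRIORITY for HC(X⁴ₘ) at every odd `m ≤ 199` belongs to the
computer-assisted preprint [Jumagulov2026OddFermatFourfolds] (arXiv:2608.18134, July 2026; Thm 1.1, census Thm 1.5), whose Appendix C row at this level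
(`m = 69, 87, 93`: 372 / 570 / 646 Galois orbits = 371 / 569 / 645 decomposable + 1 quasi-decomposable each) the cell reproduces by two independent enumerations (`code/lit/census/orbits.py`); the certificates built on this
file are INDEPENDENT ones, checked by the Lean kernel, not first claims.

References: [Shioda1979PJA] T. Shioda, Proc. Japan Acad. 55A (1979) §1 (eqs. (2)–(3), Definition (i)–(iii), (Pⁿₘ)), §2 Thm 1;
[daSilva2021HodgeFermat] G. da Silva Jr., Experimental Results 2 (2021) e22, Def. 2.4, Prop. 3.1.
[Jumagulov2026OddFermatFourfolds] R. Jumagulov, arXiv:2608.18134 (preprint, July 2026), Thm 1.1, Thm 1.5, Appendix C.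
-/

namespace Summit.HodgeConjecture.FermatCycles.ShiodaConditionFourfold

open Multiset
open Literature.AlgebraicGeometry.HodgeTheory Literature.AlgebraicGeometry.HodgeTheory.FermatCharacter
open Literature.AlgebraicGeometry.Shioda1982

/-! ### Invariance under the unit group -/

/-- `Σ (c·aᵢ) = c · Σ aᵢ`. [folklore] -/
theorem sum_map_const_mul {N : ℕ} (c : ZMod N) (s : Multiset (ZMod N)) : (s.map fun a ↦ c * a).sum = c * s.sum := by
  induction s using Multiset.induction_on with
  | empty => simp
  | cons a s ih => simp [Multiset.map_cons, Multiset.sum_cons, ih, mul_add]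

/-- Multiplication by a unit is injective on `ℤ/N`. [folklore] -/
theorem unitMul_injective {N : ℕ} (u : (ZMod N)ˣ) : Function.Injective fun a : ZMod N ↦ (u : ZMod N) * a := by
  intro a b hab
  simpa using congrArg (fun x ↦ ((u⁻¹ : (ZMod N)ˣ) : ZMod N) * x) hab

/-- `u · (u⁻¹ · s) = s`. [folklore] -/
theorem map_unit_map_inv {N : ℕ} (u : (ZMod N)ˣ) (s : Multiset (ZMod N)) :
    (s.map fun a ↦ ((u⁻¹ : (ZMod N)ˣ) : ZMod N) * a).map (fun a ↦ (u : ZMod N) * a) = s := by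
  rw [Multiset.map_map]
  conv_rhs => rw [← Multiset.map_id s]
  exact Multiset.map_congr rfl fun x _ ↦ by simp

/-- Shioda's `Mₘ` is stable under the unit group: `s` Hodge ⇒ `u·s` Hodge (the defining equations (2) run over all units).
[cite: Shioda1979PJA, §1 eq. (2)] -/
theorem isHodgeMultiset_map_unit {N : ℕ} [NeZero N] (u : (ZMod N)ˣ) {s : Multiset (ZMod N)} (hs : IsHodgeMultiset s) :
    IsHodgeMultiset (s.map fun a ↦ (u : ZMod N) * a) := by
  refine ⟨⟨?_, ?_⟩, fun t ↦ ?_⟩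
  · intro b hb
    obtain ⟨a, ha, rfl⟩ := Multiset.mem_map.mp hb
    exact (Units.mul_right_eq_zero u).not.mpr (hs.1.1 a ha)
  · rw [sum_map_const_mul, hs.1.2, mul_zero]
  · have h := hs.2 (t * u)
    have hfun : (fun a : ZMod N ↦ ((t * u : (ZMod N)ˣ) : ZMod N) * a) =
        (fun a : ZMod N ↦ (t : ZMod N) * a) ∘ (fun a : ZMod N ↦ (u : ZMod N) * a) := by
      funext a; simp [mul_assoc]
    rw [hfun, ← Multiset.map_map] at h
    rwa [Multiset.card_map]

/-- Decomposability is invariant under the unit group. [cite: Shioda1979PJA, §1 Definition (i)] -/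
theorem isDecomposable_map_unit {N : ℕ} [NeZero N] (u : (ZMod N)ˣ) {s : Multiset (ZMod N)} (h : IsDecomposable s) :
    IsDecomposable (s.map fun a ↦ (u : ZMod N) * a) := by
  obtain ⟨t, w, ht0, hw0, ht, hw, rfl⟩ := h
  exact ⟨t.map _, w.map _, by simpa using ht0, by simpa using hw0, isHodgeMultiset_map_unit u ht,
    isHodgeMultiset_map_unit u hw, Multiset.map_add _ _ _⟩

/-- Semi-decomposability is invariant under the unit group. [cite: Shioda1979PJA, §1 Definition (iii)] -/
theorem isSemiDecomposable_map_unit {N : ℕ} (u : (ZMod N)ˣ) {s : Multiset (ZMod N)} (h : IsSemiDecomposable s) :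
    IsSemiDecomposable (s.map fun a ↦ (u : ZMod N) * a) := by
  obtain ⟨t, w, ht3, hw3, hts, hws, rfl⟩ := h
  refine ⟨t.map _, w.map _, by simp [ht3], by simp [hw3], ?_, ?_, Multiset.map_add _ _ _⟩
  · rw [sum_map_const_mul, hts, mul_zero]
  · rw [sum_map_const_mul, hws, mul_zero]

/-- Quasi-decomposability (da Silva's form) is invariant under the unit group. [cite: daSilva2021HodgeFermat, Def. 2.4] -/
theorem isQuasiDecomposable_map_unit {N : ℕ} [NeZero N] (u : (ZMod N)ˣ) {s : Multiset (ZMod N)} (h : IsQuasiDecomposable s) :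
    IsQuasiDecomposable (s.map fun a ↦ (u : ZMod N) * a) := by
  obtain ⟨e, he, t, w, ht0, hw0, ht, hw, hts, hws, heq⟩ := h
  refine ⟨(u : ZMod N) * e, (Units.mul_right_eq_zero u).not.mpr he, t.map _, w.map _, by simpa using ht0, by simpa using hw0,
    isHodgeMultiset_map_unit u ht, isHodgeMultiset_map_unit u hw, ?_, ?_, ?_⟩
  · exact fun hEq ↦ hts (Multiset.map_injective (unitMul_injective u) hEq)
  · exact fun hEq ↦ hws (Multiset.map_injective (unitMul_injective u) hEq)
  · have h2 := congrArg (Multiset.map fun a ↦ (u : ZMod N) * a) heq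
    rw [Multiset.map_add, Multiset.map_add] at h2
    simpa [Multiset.insert_eq_cons, mul_neg] using h2

/-- The conclusion of `(P⁴_N)` descends along `s ↦ u⁻¹·s`. [cite: Shioda1979PJA, §1] -/
theorem p4_of_map_inv_unit {N : ℕ} [NeZero N] (u : (ZMod N)ˣ) {s : Multiset (ZMod N)}
    (h : IsDecomposable (s.map fun a ↦ ((u⁻¹ : (ZMod N)ˣ) : ZMod N) * a) ∨
      IsQuasiDecomposable (s.map fun a ↦ ((u⁻¹ : (ZMod N)ˣ) : ZMod N) * a) ∨
        IsSemiDecomposable (s.map fun a ↦ ((u⁻¹ : (ZMod N)ˣ) : ZMod N) * a)) :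
    IsDecomposable s ∨ IsQuasiDecomposable s ∨ IsSemiDecomposable s := by
  rw [← map_unit_map_inv u s]
  rcases h with h | h | h
  · exact Or.inl (isDecomposable_map_unit u h)
  · exact Or.inr (Or.inl (isQuasiDecomposable_map_unit u h))
  · exact Or.inr (Or.inr (isSemiDecomposable_map_unit u h))

/-! ### The two searches -/

/-- Case U (the multiset contains `1`): all sorted `b ≤ c ≤ d ≤ e ≤ f` with `1 + b + c + d + e + f = 3N`, first free representative
`b ∈ [b₀, b₀ + len)`; each tuple `(1, b, c, d, e, f)` fails the Hodge test or carries a witness. [cite: Shioda1979PJA, §1 condition (Pⁿₘ), n = 4] -/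
def checkU (N : ℕ) (b0 len : ℕ) : Bool :=
  (List.range' b0 len).all fun b ↦ (List.range' b (N - b)).all fun c ↦ (List.range' c (N - c)).all fun d ↦
    (List.range' (eLo N (1 + b + c + d) d) (eHi N (1 + b + c + d) + 1 - eLo N (1 + b + c + d) d)).all fun e ↦
      (!(hodgeB6 N 1 b c d e (3 * N - (1 + b + c + d + e))) || restB6 N 1 b c d e)

/-- The non-unit residues `0 < x < N`, `gcd(x, N) ≠ 1`. [folklore] -/
def nonunits (N : ℕ) : List ℕ := (List.range N).filter fun x ↦ x ≠ 0 ∧ Nat.gcd x N ≠ 1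

/-- Membership in `nonunits`. [folklore] -/
theorem mem_nonunits {N x : ℕ} : x ∈ nonunits N ↔ x < N ∧ x ≠ 0 ∧ Nat.gcd x N ≠ 1 := by
  simp [nonunits, List.mem_filter, List.mem_range]

/-- Case N (no unit entry): all sorted `6`-tuples of non-units `a ≤ b ≤ c ≤ d ≤ e ≤ f` with `Σ = 3N`; each fails the Hodge test or
carries a witness (a unit `e` is skipped: such tuples belong to case U). [cite: Shioda1979PJA, §1 condition (Pⁿₘ), n = 4] -/
def checkNU (N : ℕ) : Bool :=
  (nonunits N).all fun a ↦ ((nonunits N).filter (a ≤ ·)).all fun b ↦ ((nonunits N).filter (b ≤ ·)).all fun c ↦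
    ((nonunits N).filter (c ≤ ·)).all fun d ↦
      (List.range' (eLo N (a + b + c + d) d) (eHi N (a + b + c + d) + 1 - eLo N (a + b + c + d) d)).all fun e ↦
        (Nat.gcd e N == 1) || (!(hodgeB6 N a b c d e (3 * N - (a + b + c + d + e))) || restB6 N a b c d e)

/-! ### Soundness -/

/-- Unpacking `checkU`. [folklore] -/
theorem restB6_of_checkU {N b0 len : ℕ} (h : checkU N b0 len = true) {b c d e : ℕ}
    (hb0 : b0 ≤ b) (hb1 : b < b0 + len) (hbc : b ≤ c) (hc : c < N) (hcd : c ≤ d) (hd : d < N)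
    (hde : d ≤ e) (hef : e ≤ 3 * N - (1 + b + c + d + e)) (hf : 3 * N - (1 + b + c + d + e) < N)
    (hsum : 1 + b + c + d + e ≤ 3 * N)
    (hh : hodgeB6 N 1 b c d e (3 * N - (1 + b + c + d + e)) = true) :
    restB6 N 1 b c d e = true := by
  unfold checkU at h
  rw [List.all_eq_true] at h
  have h2 := h b (List.mem_range'_1.mpr ⟨hb0, hb1⟩)
  rw [List.all_eq_true] at h2
  have h3 := h2 c (List.mem_range'_1.mpr ⟨hbc, by omega⟩)
  rw [List.all_eq_true] at h3
  have h4 := h3 d (List.mem_range'_1.mpr ⟨hcd, by omega⟩)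
  rw [List.all_eq_true] at h4
  have hlo : eLo N (1 + b + c + d) d ≤ e := by unfold eLo; omega
  have hhi : e ≤ eHi N (1 + b + c + d) := by unfold eHi; omega
  have h5 := h4 e (List.mem_range'_1.mpr ⟨hlo, by omega⟩)
  simpa [hh] using h5

/-- Unpacking `checkNU`. [folklore] -/
theorem restB6_of_checkNU {N : ℕ} (h : checkNU N = true) {a b c d e : ℕ}
    (ha : a ∈ nonunits N) (hb : b ∈ nonunits N) (hc : c ∈ nonunits N) (hd : d ∈ nonunits N) (he : Nat.gcd e N ≠ 1)
    (hab : a ≤ b) (hbc : b ≤ c) (hcd : c ≤ d) (hde : d ≤ e) (hef : e ≤ 3 * N - (a + b + c + d + e))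
    (hf : 3 * N - (a + b + c + d + e) < N) (hsum : a + b + c + d + e ≤ 3 * N)
    (hh : hodgeB6 N a b c d e (3 * N - (a + b + c + d + e)) = true) :
    restB6 N a b c d e = true := by
  unfold checkNU at h
  rw [List.all_eq_true] at h
  have h1 := h a ha
  rw [List.all_eq_true] at h1
  have h2 := h1 b (List.mem_filter.mpr ⟨hb, by simpa using hab⟩)
  rw [List.all_eq_true] at h2
  have h3 := h2 c (List.mem_filter.mpr ⟨hc, by simpa using hbc⟩)
  rw [List.all_eq_true] at h3
  have h4 := h3 d (List.mem_filter.mpr ⟨hd, by simpa using hcd⟩)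
  rw [List.all_eq_true] at h4
  have hlo : eLo N (a + b + c + d) d ≤ e := by unfold eLo; omega
  have hhi : e ≤ eHi N (a + b + c + d) := by unfold eHi; omega
  have h5 := h4 e (List.mem_range'_1.mpr ⟨hlo, by omega⟩)
  have hne : (Nat.gcd e N == 1) = false := by simpa using he
  simpa [hh, hne] using h5

/-- `sext N 1 …` of representatives is the multiset `{1, b, c, d, e, −(1+b+c+d+e)}`. [folklore] -/
theorem sext_one_val {N : ℕ} [NeZero N] (b c d e : ZMod N) :
    sext N 1 b.val c.val d.val e.val = {1, b, c, d, e, -(1 + b + c + d + e)} := by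
  simp [sext]

/-- **Case U, sorted form.** [cite: Shioda1979PJA, §1 condition (Pⁿₘ), n = 4] -/
theorem pU_of_chunks (N : ℕ) [NeZero N] [Fact (1 < N)] (chunks : List (ℕ × ℕ))
    (hcov : ∀ b, 0 < b → b < N → ∃ p ∈ chunks, p.1 ≤ b ∧ b < p.1 + p.2)
    (hs : ∀ p ∈ chunks, checkU N p.1 p.2 = true)
    (b c d e : ZMod N) (hbc : b.val ≤ c.val) (hcd : c.val ≤ d.val) (hde : d.val ≤ e.val)
    (hef : e.val ≤ (-(1 + b + c + d + e)).val) (hH : IsHodgeMultiset ({1, b, c, d, e, -(1 + b + c + d + e)} : Multiset (ZMod N))) :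
    IsDecomposable ({1, b, c, d, e, -(1 + b + c + d + e)} : Multiset (ZMod N)) ∨
      IsQuasiDecomposable ({1, b, c, d, e, -(1 + b + c + d + e)} : Multiset (ZMod N)) ∨
        IsSemiDecomposable ({1, b, c, d, e, -(1 + b + c + d + e)} : Multiset (ZMod N)) := by
  have h1 : (1 : ZMod N).val = 1 := ZMod.val_one N
  have hb := ZMod.val_lt b
  have hc := ZMod.val_lt c
  have hd := ZMod.val_lt d
  have hflt := ZMod.val_lt (-(1 + b + c + d + e))
  have hsum := sum_val_eq_of_isHodgeMultiset_six hH
  rw [h1] at hsum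
  have hfv : (-(1 + b + c + d + e)).val = 3 * N - (1 + b.val + c.val + d.val + e.val) := by omega
  have hh := hodgeB6_of_isHodgeMultiset hH
  rw [h1, hfv] at hh
  rw [hfv] at hef hflt
  have hb0 : b ≠ 0 := hH.1.1 b (by simp)
  have hbpos : 0 < b.val := by
    rcases Nat.eq_zero_or_pos b.val with h0 | h0
    · exact absurd ((ZMod.val_eq_zero b).mp h0) hb0
    · exact h0
  obtain ⟨p, hp, hp0, hp1⟩ := hcov b.val hbpos hb
  have h6 : card ({1, b, c, d, e, -(1 + b + c + d + e)} : Multiset (ZMod N)) = 6 := by simp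
  have hr := restB6_of_checkU (hs p hp) hp0 hp1 hbc hc hcd hd hde hef hflt (by omega) hh
  unfold restB6 at hr
  rw [sext_one_val] at hr
  simp only [Bool.or_eq_true, decide_eq_true_eq] at hr
  rcases hr with (hP | hS) | hQ
  · exact Or.inl (isDecomposable_of_hasPair hH h6 hP)
  · exact Or.inr (Or.inr (isSemiDecomposable_of_semiB h6 hS))
  · exact Or.inr (Or.inl (isQuasiDecomposable_of_quasiB h6 hQ))

/-- A non-unit residue has a representative in `nonunits`. [folklore] -/
theorem val_mem_nonunits {N : ℕ} [NeZero N] {x : ZMod N} (hx0 : x ≠ 0) (hx : ¬ IsUnit x) : x.val ∈ nonunits N := by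
  refine mem_nonunits.mpr ⟨ZMod.val_lt x, fun h0 ↦ hx0 ((ZMod.val_eq_zero x).mp h0), fun hg ↦ hx ?_⟩
  have := (ZMod.isUnit_iff_coprime x.val N).mpr hg
  rwa [ZMod.natCast_zmod_val] at this

/-- **Case N, sorted form.** [cite: Shioda1979PJA, §1 condition (Pⁿₘ), n = 4] -/
theorem pN_of_checkNU (N : ℕ) [NeZero N] (hs : checkNU N = true)
    (a b c d e : ZMod N) (hab : a.val ≤ b.val) (hbc : b.val ≤ c.val) (hcd : c.val ≤ d.val) (hde : d.val ≤ e.val)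
    (hef : e.val ≤ (-(a + b + c + d + e)).val)
    (hua : ¬ IsUnit a) (hub : ¬ IsUnit b) (huc : ¬ IsUnit c) (hud : ¬ IsUnit d) (hue : ¬ IsUnit e)
    (hH : IsHodgeMultiset ({a, b, c, d, e, -(a + b + c + d + e)} : Multiset (ZMod N))) :
    IsDecomposable ({a, b, c, d, e, -(a + b + c + d + e)} : Multiset (ZMod N)) ∨
      IsQuasiDecomposable ({a, b, c, d, e, -(a + b + c + d + e)} : Multiset (ZMod N)) ∨
        IsSemiDecomposable ({a, b, c, d, e, -(a + b + c + d + e)} : Multiset (ZMod N)) := by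
  have hflt := ZMod.val_lt (-(a + b + c + d + e))
  have hsum := sum_val_eq_of_isHodgeMultiset_six hH
  have hfv : (-(a + b + c + d + e)).val = 3 * N - (a.val + b.val + c.val + d.val + e.val) := by omega
  have hh := hodgeB6_of_isHodgeMultiset hH
  rw [hfv] at hh hef hflt
  have hma := val_mem_nonunits (hH.1.1 a (by simp)) hua
  have hmb := val_mem_nonunits (hH.1.1 b (by simp)) hub
  have hmc := val_mem_nonunits (hH.1.1 c (by simp)) huc
  have hmd := val_mem_nonunits (hH.1.1 d (by simp)) hud
  have hme : Nat.gcd e.val N ≠ 1 := (mem_nonunits.mp (val_mem_nonunits (hH.1.1 e (by simp)) hue)).2.2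
  have h6 : card ({a, b, c, d, e, -(a + b + c + d + e)} : Multiset (ZMod N)) = 6 := by simp
  have hr := restB6_of_checkNU hs hma hmb hmc hmd hme hab hbc hcd hde hef hflt (by omega) hh
  unfold restB6 at hr
  rw [sext_val] at hr
  simp only [Bool.or_eq_true, decide_eq_true_eq] at hr
  rcases hr with (hP | hS) | hQ
  · exact Or.inl (isDecomposable_of_hasPair hH h6 hP)
  · exact Or.inr (Or.inr (isSemiDecomposable_of_semiB h6 hS))
  · exact Or.inr (Or.inl (isQuasiDecomposable_of_quasiB h6 hQ))

/-- **Soundness of the normalised search.** If the case-U chunks cover `[1, N)` and pass `checkU`, and `checkNU` passes, then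
`(P⁴_N)` = `ShiodaConditionUpTo N 4`. (A Hodge `6`-multiset with a unit entry `a` is `a · s'` with `1 ∈ s'`, sort the other five
entries of `s'` and use case U, then transport back by `a`; otherwise all entries are non-units: sort all six and use case N.)
[cite: Shioda1979PJA, §1 condition (Pⁿₘ), n = 4] -/
theorem shiodaConditionUpTo_four_of_normalized (N : ℕ) [NeZero N] [Fact (1 < N)] (chunksU : List (ℕ × ℕ))
    (hcov : ∀ b, 0 < b → b < N → ∃ p ∈ chunksU, p.1 ≤ b ∧ b < p.1 + p.2)
    (hU : ∀ p ∈ chunksU, checkU N p.1 p.2 = true) (hNU : checkNU N = true) : ShiodaConditionUpTo N 4 := by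
  intro s hH h6 h6'
  have hcard : card s = 6 := by omega
  by_cases hex : ∃ a ∈ s, IsUnit a
  · -- case U: scale a unit entry to 1
    obtain ⟨a, ha, hua⟩ := hex
    set u : (ZMod N)ˣ := hua.unit with hu
    have hua' : (u : ZMod N) = a := hua.unit_spec
    set s' : Multiset (ZMod N) := s.map fun x ↦ ((u⁻¹ : (ZMod N)ˣ) : ZMod N) * x with hs'
    have hH' : IsHodgeMultiset s' := isHodgeMultiset_map_unit u⁻¹ hH
    have hcard' : card s' = 6 := by rw [hs', Multiset.card_map, hcard]
    have h1 : (1 : ZMod N) ∈ s' := by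
      rw [hs', Multiset.mem_map]
      exact ⟨a, ha, by rw [← hua', Units.inv_mul]⟩
    obtain ⟨r, hr⟩ := Multiset.exists_cons_of_mem h1
    have hcr : card r = 5 := by
      have := congrArg card hr
      rw [hcard', Multiset.card_cons] at this
      omega
    obtain ⟨v, hvs, hsorted⟩ : ∃ v : List ℕ, (v : Multiset ℕ) = r.map ZMod.val ∧ v.Pairwise (· ≤ ·) :=
      ⟨(r.map ZMod.val).sort, Multiset.sort_eq _ _, Multiset.pairwise_sort _ _⟩
    have hlen : v.length = 5 := by
      have := congrArg Multiset.card hvs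
      simpa [hcr] using this
    obtain ⟨b', v2, rfl⟩ := List.exists_of_length_succ v hlen
    obtain ⟨c', v3, rfl⟩ := List.exists_of_length_succ v2 (by simpa using hlen)
    obtain ⟨d', v4, rfl⟩ := List.exists_of_length_succ v3 (by simpa using hlen)
    obtain ⟨e', v5, rfl⟩ := List.exists_of_length_succ v4 (by simpa using hlen)
    obtain ⟨f', v6, rfl⟩ := List.exists_of_length_succ v5 (by simpa using hlen)
    have hv6 : v6 = [] := by simpa using hlen
    subst hv6
    have hlt : ∀ x ∈ ([b', c', d', e', f'] : List ℕ), x < N := by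
      intro x hx
      have hx' : x ∈ r.map ZMod.val := by rw [← hvs]; exact Multiset.mem_coe.mpr hx
      obtain ⟨y, -, rfl⟩ := Multiset.mem_map.mp hx'
      exact ZMod.val_lt y
    have hb' : b' < N := hlt b' (by simp)
    have hc' : c' < N := hlt c' (by simp)
    have hd' : d' < N := hlt d' (by simp)
    have he' : e' < N := hlt e' (by simp)
    have hf' : f' < N := hlt f' (by simp)
    have hr' : r = {(b' : ZMod N), (c' : ZMod N), (d' : ZMod N), (e' : ZMod N), (f' : ZMod N)} := by
      have hr1 : r = (r.map ZMod.val).map (fun n : ℕ ↦ (n : ZMod N)) := by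
        rw [Multiset.map_map]
        conv_lhs => rw [← Multiset.map_id r]
        refine Multiset.map_congr rfl fun x _ ↦ ?_
        simp
      rw [hr1, ← hvs]
      rfl
    have hsum : (f' : ZMod N) = -(1 + (b' : ZMod N) + (c' : ZMod N) + (d' : ZMod N) + (e' : ZMod N)) := by
      have h0 := hH'.1.2
      rw [hr, hr'] at h0
      simp only [Multiset.insert_eq_cons, Multiset.sum_cons, Multiset.sum_singleton] at h0
      linear_combination h0
    have hs'eq : s' = {1, (b' : ZMod N), (c' : ZMod N), (d' : ZMod N), (e' : ZMod N),
        -(1 + (b' : ZMod N) + (c' : ZMod N) + (d' : ZMod N) + (e' : ZMod N))} := by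
      rw [hr, hr', hsum]; rfl
    rw [hs'eq] at hH'
    simp only [List.pairwise_cons, List.mem_cons, List.not_mem_nil, or_false, forall_eq_or_imp,
      forall_eq] at hsorted
    have hbc : (b' : ZMod N).val ≤ (c' : ZMod N).val := by
      rw [ZMod.val_natCast_of_lt hb', ZMod.val_natCast_of_lt hc']; omega
    have hcd : (c' : ZMod N).val ≤ (d' : ZMod N).val := by
      rw [ZMod.val_natCast_of_lt hc', ZMod.val_natCast_of_lt hd']; omega
    have hde : (d' : ZMod N).val ≤ (e' : ZMod N).val := by
      rw [ZMod.val_natCast_of_lt hd', ZMod.val_natCast_of_lt he']; omega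
    have hef : (e' : ZMod N).val ≤ (-(1 + (b' : ZMod N) + (c' : ZMod N) + (d' : ZMod N) + (e' : ZMod N))).val := by
      rw [← hsum, ZMod.val_natCast_of_lt he', ZMod.val_natCast_of_lt hf']; omega
    have key := pU_of_chunks N chunksU hcov hU _ _ _ _ hbc hcd hde hef hH'
    rw [← hs'eq] at key
    exact p4_of_map_inv_unit u key
  · -- case N: no unit entry
    push Not at hex
    obtain ⟨v, hvs, hsorted⟩ : ∃ v : List ℕ, (v : Multiset ℕ) = s.map ZMod.val ∧ v.Pairwise (· ≤ ·) :=
      ⟨(s.map ZMod.val).sort, Multiset.sort_eq _ _, Multiset.pairwise_sort _ _⟩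
    have hlen : v.length = 6 := by
      have := congrArg Multiset.card hvs
      simpa [hcard] using this
    obtain ⟨a', v1, rfl⟩ := List.exists_of_length_succ v hlen
    obtain ⟨b', v2, rfl⟩ := List.exists_of_length_succ v1 (by simpa using hlen)
    obtain ⟨c', v3, rfl⟩ := List.exists_of_length_succ v2 (by simpa using hlen)
    obtain ⟨d', v4, rfl⟩ := List.exists_of_length_succ v3 (by simpa using hlen)
    obtain ⟨e', v5, rfl⟩ := List.exists_of_length_succ v4 (by simpa using hlen)
    obtain ⟨f', v6, rfl⟩ := List.exists_of_length_succ v5 (by simpa using hlen)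
    have hv6 : v6 = [] := by simpa using hlen
    subst hv6
    have hlt : ∀ x ∈ ([a', b', c', d', e', f'] : List ℕ), x < N := by
      intro x hx
      have hx' : x ∈ s.map ZMod.val := by rw [← hvs]; exact Multiset.mem_coe.mpr hx
      obtain ⟨y, -, rfl⟩ := Multiset.mem_map.mp hx'
      exact ZMod.val_lt y
    have ha' : a' < N := hlt a' (by simp)
    have hb' : b' < N := hlt b' (by simp)
    have hc' : c' < N := hlt c' (by simp)
    have hd' : d' < N := hlt d' (by simp)
    have he' : e' < N := hlt e' (by simp)
    have hf' : f' < N := hlt f' (by simp)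
    have hs' : s = {(a' : ZMod N), (b' : ZMod N), (c' : ZMod N), (d' : ZMod N), (e' : ZMod N), (f' : ZMod N)} := by
      have h1 : s = (s.map ZMod.val).map (fun n : ℕ ↦ (n : ZMod N)) := by
        rw [Multiset.map_map]
        conv_lhs => rw [← Multiset.map_id s]
        refine Multiset.map_congr rfl fun x _ ↦ ?_
        simp
      rw [h1, ← hvs]
      rfl
    have hmem : ∀ x ∈ ({(a' : ZMod N), (b' : ZMod N), (c' : ZMod N), (d' : ZMod N), (e' : ZMod N), (f' : ZMod N)} :
        Multiset (ZMod N)), ¬ IsUnit x := by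
      intro x hx; rw [← hs'] at hx; exact hex x hx
    have hsum : (f' : ZMod N) = -((a' : ZMod N) + (b' : ZMod N) + (c' : ZMod N) + (d' : ZMod N) + (e' : ZMod N)) := by
      have h0 := hH.1.2
      rw [hs'] at h0
      simp only [Multiset.insert_eq_cons, Multiset.sum_cons, Multiset.sum_singleton] at h0
      linear_combination h0
    have hua : ¬ IsUnit (a' : ZMod N) := hmem _ (by simp)
    have hub : ¬ IsUnit (b' : ZMod N) := hmem _ (by simp)
    have huc : ¬ IsUnit (c' : ZMod N) := hmem _ (by simp)
    have hud : ¬ IsUnit (d' : ZMod N) := hmem _ (by simp)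
    have hue : ¬ IsUnit (e' : ZMod N) := hmem _ (by simp)
    rw [hs', hsum] at hH ⊢
    simp only [List.pairwise_cons, List.mem_cons, List.not_mem_nil, or_false, forall_eq_or_imp,
      forall_eq] at hsorted
    have hab : (a' : ZMod N).val ≤ (b' : ZMod N).val := by
      rw [ZMod.val_natCast_of_lt ha', ZMod.val_natCast_of_lt hb']; omega
    have hbc : (b' : ZMod N).val ≤ (c' : ZMod N).val := by
      rw [ZMod.val_natCast_of_lt hb', ZMod.val_natCast_of_lt hc']; omega
    have hcd : (c' : ZMod N).val ≤ (d' : ZMod N).val := by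
      rw [ZMod.val_natCast_of_lt hc', ZMod.val_natCast_of_lt hd']; omega
    have hde : (d' : ZMod N).val ≤ (e' : ZMod N).val := by
      rw [ZMod.val_natCast_of_lt hd', ZMod.val_natCast_of_lt he']; omega
    have hef : (e' : ZMod N).val ≤ (-((a' : ZMod N) + (b' : ZMod N) + (c' : ZMod N) + (d' : ZMod N) + (e' : ZMod N))).val := by
      rw [← hsum, ZMod.val_natCast_of_lt he', ZMod.val_natCast_of_lt hf']; omega
    exact pN_of_checkNU N hNU _ _ _ _ _ hab hbc hcd hde hef hua hub huc hud hue hH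

end Summit.HodgeConjecture.FermatCycles.ShiodaConditionFourfold
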